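import Summits.CriticalPhenomena.PercolationContinuityZ3.Theorems.PercNearOneGluingNoHeavyPcintUFibZ4
import Summits.CriticalPhenomena.PercolationContinuityZ3.Theorems.PercNearOneGluingNoHeavyPcintUFibZ9Rows2
import HarnessLib

/-!
# PCINT lane — STRUCTURE conjecture **C-T2** (dense-type law of the usable-set comparison, complete bipartite fibres), TYPED

HONEST FRAMING: a statement about the lane's own comparison inequalities (the closed form `UFib.cf` of
`…PcintUFibBipSum.lean`), found numerically, pre-registered three times and scored HIT ×3 each; NOT a theorem and NOT used
by any certified cell (the cells `UFib.siteCriticalProb_Z{d}_le_{P}` check ALL types by kernel computation).  Coordinator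
STANDING RULE 2026-08-22 «NUMERICS ⇒ STRUCTURE ⇒ CONJECTURE», item (5): a conjecture surviving three pre-registered
predictions is typed as a Lean `Prop` with its evidence ledger (no `Conjectures/` target exists under this summit, so the
file sits with the lane's `Pcint.UFib` files, like `…PcintMemoryTailLaw.lean`).  Statement of record:
run/shared/lean/prim/pcint/STRUCTURE.md §2 (C-T2) / §3 (P-T2, P-T3, P-T4) / §5.

THE OBJECTS.  For the complete bipartite fibre `K_{n,n}` at density `p`, comparison level `s = 0.5001`, a TYPE `(ha, hb)`
(sizes of the two sides of the examiner's usable set), `k ≤ 5` children and a level `1 ≤ j ≤ k`, the tail inequality of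
`UFib.dominating` reads, by `UFib.sum_wt_meetsU_υB`,
`tailIneq n ha hb k j p : cf n n ha hb p 1 · bt k s j ≤ cf n n ha hb p (u ↦ bt k (1−(1−p)^u) j)`;
`tableHolds n p` = all of them; `pstar n = inf {p ∈ [0,1] : tableHolds n p}` is the comparison threshold of `K_{n,n}`.

THE LAW (C-T2).  (a) `singleBinding`: the whole table is implied by the `(k,j) = (5,1)` inequalities ("no child reached")
at the SYMMETRIC types `(h,h)` — numerically the binding one is a single `(h(n), h(n))` with `h = 1,1,1,1,1,2,2,3,3,4,4,4,5,·,6,·,7,·,8,·,9,·,10`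
for `n = 2..24`; (b) `convexThresholds`: `n ↦ pstar n` is non-increasing and convex from `n = 4` on.
MECHANISM: conditioning a fresh `Bern(p)` fibre on "meets `H`" carries the least information per cell when `H` is a small
dense set, and for complete bipartite fibres the symmetric types minimise the expected usable-set size among types of the
same total size; the all-fail event `j = 1`, `k = 5` is the extreme down-set of the children law.

EVIDENCE LEDGER (prim-pcint-1 gen 12; scripts prim-pcint-1/gen12/num/knn.py (closed form, floats) and cfcheck.py (exact
rationals = this file's `cf`); all thresholds = bisection on the minimum slack over ALL `(ha,hb,k,j)`):
`pstar` ≈ 0.41420 (n=2) 0.37323 0.33964 0.31174 0.28828 0.26887 0.25212 0.23763 0.22511 0.21397 0.20425 0.19548 0.18768 (14)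
0.17418 (16) 0.16297 (18) 0.15349 (20) 0.14537 (22) 0.13831 (24); binding always `(5,1)` at `(h,h)` as listed; decrements
0.0135, 0.0112, 0.0095, 0.0081, 0.0071 (shrinking).  The same law (binding `(5,1)` at the smallest dense type: clique /
triangle / edge) was observed for ALL ≈ 100 other fibre graphs scanned (cycles, 85 circulants, 5 tori; gen12/num/fibc.c).
PRE-REGISTERED (files sealed by sha256 in run/shared/lean/prim/pcint/predictions/ BEFORE the runs): P-T2 (2026-08-22T22:56Z,
e657efa6…): K_{14,14} ∈ [0.1873,0.1882] (5,5) → 0.18768 (5,5) HIT; K_{16,16} ∈ [0.1735,0.1755] → 0.17418 (6,6) HIT; torus C₅×C₅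
edge-binding ∈ [0.33875,0.33890] → 0.338793 HIT.  P-T3 (2026-08-23T04:02Z, ea3bc4c5…): K_{18,18} ∈ [0.1615,0.1640] (7,7) → 0.16297
(7,7) HIT; K_{20,20} ∈ [0.1505,0.1540] (8,8) → 0.15349 (8,8) HIT; shrinking decrements HIT.  P-T4 (04:12Z, 56f9a883…): K_{22,22} ∈
[0.1445,0.1465] (9,9) → 0.14537 (9,9) HIT; K_{24,24} ∈ [0.1375,0.1398] (10,10) → 0.13831 (10,10) HIT; decrements HIT.
KERNEL SANITY (proved below, no `sorry`): the table holds at the landed cells — `tableHolds 2 0.4143` (from `UFib.checkBip_4`)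
and `tableHolds 12 0.2043` (`UFib.checkBip_9`) — hence `pstar 2 ≤ 0.4143`, `pstar 12 ≤ 0.2043`.

Change log: 2026-08-23 prim-pcint-1 gen 12 (prover-prim-pcint-1-g12-0): v1.
-/

noncomputable section

namespace Summit.CriticalPhenomena.PercolationContinuityZ3.Theorems.Pcint.UFib.DenseType

open Summit.CriticalPhenomena.PercolationContinuityZ3.Theorems.Pcint.UFib

/-- The comparison level `s = 0.5001` of the lane's T-fibre cells. -/
def sLane : ℝ := 5001 / 10000

/-- **One tail inequality** of the usable-set comparison for the complete bipartite fibre `K_{n,n}` (closed form `UFib.cf`):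
type `(ha, hb)`, `k` children, level `j`, density `p`. -/
def tailIneq (n ha hb k j : ℕ) (p : ℝ) : Prop :=
  cf n n ha hb p (fun _ => 1) * bt k sLane j ≤ cf n n ha hb p (fun u => bt k (1 - (1 - p) ^ u) j)

/-- **The whole tail table** of `K_{n,n}` at density `p` (all types, `k ≤ 5`, `1 ≤ j ≤ k`). -/
def tableHolds (n : ℕ) (p : ℝ) : Prop :=
  ∀ ha hb k j : ℕ, ha ≤ n → hb ≤ n → k ≤ 5 → 1 ≤ j → j ≤ k → tailIneq n ha hb k j p

/-- **The comparison threshold of `K_{n,n}`**: the least density at which the whole table holds. -/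
def pstar (n : ℕ) : ℝ := sInf {p : ℝ | 0 ≤ p ∧ p ≤ 1 ∧ tableHolds n p}

/-- **C-T2 (a), single binding inequality** (STRUCTURE.md C-T2; pre-registered P-T2/P-T3/P-T4, HIT ×3 each): for every
`n ≥ 2` and `p ∈ (0,1)`, the `(k,j) = (5,1)` inequalities at the symmetric types `(h,h)` imply the whole tail table. -/
@[conjecture] def singleBinding : Prop :=
  ∀ n : ℕ, 2 ≤ n → ∀ p : ℝ, 0 < p → p < 1 → (∀ h : ℕ, h ≤ n → tailIneq n h h 5 1 p) → tableHolds n p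

/-- **C-T2 (b), monotone convex thresholds** (STRUCTURE.md C-T2; P-T3/P-T4 items 3, HIT): from `n = 4` on the comparison
threshold of `K_{n,n}` is non-increasing in `n` with non-increasing decrements. -/
@[conjecture] def convexThresholds : Prop :=
  ∀ n : ℕ, 4 ≤ n → pstar (n + 1) ≤ pstar n ∧ pstar (n + 1) - pstar (n + 2) ≤ pstar n - pstar (n + 1)

/-! ### Kernel sanity: the table holds at the landed cells -/

/-- The table of `UFib.dominating` from a passed `UFib.checkBip`, in the language of this file. -/
theorem tableHolds_of_checkBip {n P : ℕ} (h : checkBip n n ((P : ℚ) / 10000) (5001 / 10000) = true) :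
    tableHolds n ((P : ℝ) / 10000) := by
  intro ha hb k j hha hhb hk hj1 hjk
  have t := tail_of_checkBip h hha hhb hk hj1 hjk
  have hp : ((((P : ℚ) / 10000 : ℚ) : ℝ)) = (P : ℝ) / 10000 := by push_cast; ring
  have hs : ((((5001 : ℚ) / 10000 : ℚ) : ℝ)) = sLane := by unfold sLane; push_cast; ring
  rw [hp, hs] at t
  unfold tailIneq
  simpa only [bt_eq_binTail] using t

/-- **The table of `K_{2,2}` holds at `p = 0.4143`** (the landed `ℤ⁴` cell; kernel computation `UFib.checkBip_4`). -/
theorem tableHolds_two : tableHolds 2 ((4143 : ℝ) / 10000) :=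
  tableHolds_of_checkBip (n := 2) (P := 4143) (by exact_mod_cast checkBip_4)

/-- **The table of `K_{12,12}` holds at `p = 0.2043`** (the landed `ℤ⁹` cell; kernel computation `UFib.checkBip_9`). -/
theorem tableHolds_twelve : tableHolds 12 ((2043 : ℝ) / 10000) :=
  tableHolds_of_checkBip (n := 12) (P := 2043) (by exact_mod_cast checkBip_9)

/-- The threshold is at most any density in `[0,1]` at which the table holds. -/
theorem pstar_le {n : ℕ} {p : ℝ} (hp0 : 0 ≤ p) (hp1 : p ≤ 1) (h : tableHolds n p) : pstar n ≤ p :=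
  csInf_le ⟨0, fun _ hq => hq.1⟩ ⟨hp0, hp1, h⟩

/-- **`pstar 2 ≤ 0.4143`** (numerically `pstar 2 = 0.41420…`). -/
theorem pstar_two_le : pstar 2 ≤ (4143 : ℝ) / 10000 :=
  pstar_le (by norm_num) (by norm_num) tableHolds_two

/-- **`pstar 12 ≤ 0.2043`** (numerically `pstar 12 = 0.20425…`). -/
theorem pstar_twelve_le : pstar 12 ≤ (2043 : ℝ) / 10000 :=
  pstar_le (by norm_num) (by norm_num) tableHolds_twelve

end Summit.CriticalPhenomena.PercolationContinuityZ3.Theorems.Pcint.UFib.DenseType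

end
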